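import Literature.Computability.Cryptography.VDSCopyPrimitives
import HarnessLib

/-!
# The van Dam–Seroussi copy, V: the constants

Topic `Literature/Computability/Cryptography`; sequel of `VDSCopyPrimitives.lean` for the discharge of
`VanDamSeroussi2002_gaussSumPhase_qsolvable`. The copy starts from `|0…0⟩`; its first word `constWord`
(`X = HSSH` on the set bits of the header strings and of `bin b`) prepares the label of the INITIAL
CONTENTS `cfg₀` (every header segment holds its query prefix, `Bc` holds `b`, everything else `0`):

* `xWords ws` and `xWords_mulVec_basisState` — a word of `X` gates flips each listed wire once per
  occurrence (`Nat.bodd (count w ws)`; Nielsen–Chuang 2010, Ex. 4.18);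
* `dws`, `hdrIdx_eq`, `cfg₀`, **`hdrOK_cfg₀`** (the initial contents are well formed) and the initial
  register contents `cfg₀_idx`;
* `constWires` (the wires `constWord` flips), `constWord_eq_xWords`, `mem_constWires_iff`,
  `constWires_nodup`, and **`constWord_mulVec_basisState_zero`**:
  `constWord |0…0⟩ = |lab cfg₀⟩`.

Everything is proved; no named fact.

## References

* M. A. Nielsen, I. L. Chuang, CUP 2010, §4.2 Ex. 4.18 [NielsenChuang2010].
* W. van Dam, G. Seroussi, arXiv:quant-ph/0207131 (2002), §4 Algorithm 1 [VanDamSeroussi2002].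
-/

noncomputable section

namespace Literature.Computability.Cryptography

namespace VDSCopy

open _root_.Computability Complexity QuantumComplexity QuantumComplexity.SegLayout QuantumComplexity.QFTQubits VDSOracle
open Matrix Finset

/-! ### Words of `X` gates -/

section XWords

variable {N : ℕ}

/-- `X` on each listed wire, in order. [cite: NielsenChuang2010, §4.2 Ex. 4.18] -/
def xWords (ws : List (Fin N)) : List (QGate cliffordT N) := ws.flatMap xWord

/-- **A word of `X` gates flips each wire once per occurrence.** [cite: NielsenChuang2010, §4.2 Ex. 4.18] -/
theorem xWords_mulVec_basisState (A : Language Bool) : ∀ (ws : List (Fin N)) (z : QReg N),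
    (⟨xWords ws⟩ : QCircuit cliffordT N).toMatrix A *ᵥ basisState z = basisState (fun w => (z w ^^ (ws.count w).bodd))
  | [], z => by
    rw [xWords, List.flatMap_nil, QCircuit.toMatrix_nil, Matrix.one_mulVec]
    congr 1; funext w; simp
  | w₀ :: ws, z => by
    have hsplit : (⟨xWords (w₀ :: ws)⟩ : QCircuit cliffordT N) = (⟨xWord w₀⟩ : QCircuit cliffordT N).append ⟨xWords ws⟩ := by
      simp [xWords, QCircuit.append]
    rw [hsplit, QCircuit.toMatrix_append, ← Matrix.mulVec_mulVec, xWord_mulVec_basisState, xWords_mulVec_basisState A ws]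
    congr 1
    funext w
    rw [List.count_cons]
    by_cases h : w₀ = w
    · subst h
      simp only [Function.update_self, beq_self_eq_true, if_true, Nat.bodd_succ]
      cases z w₀ <;> cases (List.count w₀ ws).bodd <;> rfl
    · rw [Function.update_of_ne (Ne.symm h)]
      simp [h]

/-- On a duplicate-free word every wire is flipped at most once. [folklore] -/
theorem xWords_mulVec_basisState_of_nodup (A : Language Bool) {ws : List (Fin N)} (h : ws.Nodup) (z : QReg N) :
    (⟨xWords ws⟩ : QCircuit cliffordT N).toMatrix A *ᵥ basisState z = basisState (fun w => (z w ^^ decide (w ∈ ws))) := by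
  rw [xWords_mulVec_basisState]
  congr 1; funext w; congr 1
  by_cases hw : w ∈ ws
  · rw [List.count_eq_one_of_mem h hw, decide_eq_true hw]; rfl
  · rw [List.count_eq_zero.2 hw, decide_eq_false hw]; rfl

/-- A conditional flat map of `X` words is a word of `X` gates. [folklore] -/
theorem flatMap_ite_xWord {m : ℕ} (e : Fin m → Fin N) (p : Fin m → Bool) : ∀ l : List (Fin m),
    l.flatMap (fun i => if p i then xWord (e i) else []) = xWords ((l.filter p).map e)
  | [] => by simp [xWords]
  | i :: l => by
    rw [List.flatMap_cons, flatMap_ite_xWord e p l, List.filter_cons]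
    cases p i <;> simp [xWords]

/-- Concatenation of `X` words. [folklore] -/
theorem xWords_append (ws ws' : List (Fin N)) : xWords (ws ++ ws') = xWords ws ++ xWords ws' := by
  simp [xWords, List.flatMap_append]

/-- A flat map of `X` words is the `X` word of the flat map. [folklore] -/
theorem flatMap_xWords {ι : Type*} (l : List ι) (f : ι → List (Fin N)) : l.flatMap (fun a => xWords (f a)) = xWords (l.flatMap f) := by
  induction l with
  | nil => simp [xWords]
  | cons a l ih => rw [List.flatMap_cons, ih, List.flatMap_cons, xWords_append]

end XWords

variable (P : Prm)

/-! ### The initial contents -/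

/-- The widths of the targets of the blocks: the layout of the header segments. [folklore] -/
def dws : List ℕ := (ops P).map fun o => wd P o.dst

/-- The header layout has the target widths. [folklore] -/
theorem dws_getD {k : ℕ} (hk : k < 26) : (dws P).getD k 0 = wd P (op P k).dst := by
  have hk' : k < (ops P).length := by rw [length_ops]; exact hk
  unfold dws op
  rw [List.getD_eq_getElem?_getD, List.getElem?_map, List.getD_eq_getElem?_getD, List.getElem?_eq_getElem hk']
  rfl

/-- The header segment index through the header layout. [folklore] -/
theorem hdrIdx_eq (k i : ℕ) : hdrIdx P k i = 22 + (pre (dws P) k + i) := by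
  unfold hdrIdx hdrBase pre dws
  rw [List.map_take]
  omega

/-- The number of header segments is the total target width. [folklore] -/
theorem length_hdrSegs : ∀ os : List Op, (hdrSegs P os).length = (os.map fun o => wd P o.dst).sum
  | [] => rfl
  | o :: os => by
    rw [hdrSegs, List.length_append, length_hdrSegs os]
    simp

/-- The number of segments of a copy. [folklore] -/
theorem length_segs : (segs P).length = 22 + (dws P).sum := by
  unfold segs dws
  simp only [List.length_cons, length_hdrSegs]
  omega

/-- **The initial contents**: `b` on `Bc`, the query prefixes on the header segments, `0` elsewhere.
[cite: VanDamSeroussi2002, §4 Algorithm 1] -/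
def cfg₀ (j : ℕ) : ℕ :=
  if j = 21 then P.b
  else if h : 22 ≤ j ∧ j - 22 < (dws P).sum then
    bitsToNat (hdrStr P (op P (segOf (segs := dws P) ⟨j - 22, h.2⟩)) (offOf (segs := dws P) ⟨j - 22, h.2⟩))
  else 0

/-- **The initial contents are well formed.** [folklore] -/
theorem hdrOK_cfg₀ : HdrOK P (cfg₀ P) := by
  intro k hk i hi
  have hi' : i < (dws P).getD k 0 := by rw [dws_getD P hk]; exact hi
  have hval : hdrIdx P k i - 22 = (emb (dws P) k ⟨i, hi'⟩ : ℕ) := by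
    rw [hdrIdx_eq, emb_val]
    show 22 + (pre (dws P) k + i) - 22 = pre (dws P) k + i
    omega
  have hlt : hdrIdx P k i - 22 < (dws P).sum := by rw [hval]; exact (emb (dws P) k ⟨i, hi'⟩).isLt
  unfold cfg₀
  rw [if_neg (by have := le_hdrIdx P k i; omega), dif_pos ⟨le_hdrIdx P k i, hlt⟩]
  have hw : (⟨hdrIdx P k i - 22, hlt⟩ : Fin (dws P).sum) = emb (dws P) k ⟨i, hi'⟩ := Fin.ext hval
  rw [hw, segOf_emb, offOf_emb]

/-- The initial contents of the registers: `b` on `Bc`, `0` elsewhere. [folklore] -/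
theorem cfg₀_idx (r : R) : cfg₀ P r.idx = if r = R.Bc then P.b else 0 := by
  unfold cfg₀
  by_cases h : r = R.Bc
  · subst h; rfl
  · have h21 : r.idx ≠ 21 := fun e => h (R.idx_injective (e.trans (rfl : (21 : ℕ) = R.Bc.idx)))
    rw [if_neg h21, dif_neg (fun hh => by have := R.idx_lt r; omega), if_neg h]

/-! ### The label of the initial contents -/

variable {P}

/-- A wire of a header segment beyond the registers determines its block and gate. [folklore] -/
theorem exists_hdr_of_le {σ : ℕ} (h22 : 22 ≤ σ) (hσ : σ < (segs P).length) :
    ∃ k, k < 26 ∧ ∃ i, i < wd P (op P k).dst ∧ σ = hdrIdx P k i := by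
  rw [length_segs] at hσ
  set w : Fin (dws P).sum := ⟨σ - 22, by omega⟩ with hw
  have hk := segOf_lt w
  have hklen : (dws P).length = 26 := by unfold dws; rw [List.length_map, length_ops]
  have hk26 : segOf w < 26 := by rw [← hklen]; exact hk
  refine ⟨segOf w, hk26, offOf w, ?_, ?_⟩
  · have := offOf_lt w; rwa [dws_getD P hk26] at this
  · rw [hdrIdx_eq, pre_add_offOf w]
    show σ = 22 + (σ - 22); omega

variable (P)

/-- **The label of the initial contents**, wire by wire: set on the set bits of `bin b` in `Bc` and of the
header strings, clear elsewhere. [folklore] -/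
theorem lab_cfg₀_eq_true_iff (w : Fin (bw P)) :
    lab P (cfg₀ P) w = true ↔
      (∃ j : Fin (wd P R.Bc), reg P R.Bc j = w ∧ P.b.testBit j = true) ∨
        ∃ k, k < 26 ∧ ∃ i : Fin (wd P (op P k).dst), ∃ o : Fin ((segs P).getD (hdrIdx P k i) 0),
          hdr P k i o = w ∧ (hdrStr P (op P k) i).getD o false = true := by
  constructor
  · intro hw
    have hlab : lab P (cfg₀ P) w = (cfg₀ P (segOf (segs := segs P) w)).testBit (offOf (segs := segs P) w) := rfl
    rw [hlab] at hw
    set σ := segOf (segs := segs P) w with hσ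
    by_cases h22 : 22 ≤ σ
    · obtain ⟨k, hk, i, hi, hki⟩ := exists_hdr_of_le h22 (segOf_lt w)
      right
      have hoff : offOf (segs := segs P) w < (segs P).getD (hdrIdx P k i) 0 := by rw [← hki]; exact offOf_lt w
      refine ⟨k, hk, ⟨i, hi⟩, ⟨offOf (segs := segs P) w, hoff⟩, ?_, ?_⟩
      · refine Fin.ext ?_
        show pre (segs P) (hdrIdx P k i) + offOf (segs := segs P) w = w
        rw [← hki]; exact pre_add_offOf w
      · rw [hki, hdrOK_cfg₀ P k hk i hi, Complexity.testBit_bitsToNat_eq_getD] at hw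
        exact hw
    · push Not at h22
      left
      -- the segment is a register; only `Bc` is set
      have hσlt : σ < 22 := h22
      obtain ⟨r, hr⟩ : ∃ r : R, r.idx = σ := by
        interval_cases σ
        exacts [⟨R.S, rfl⟩, ⟨R.T, rfl⟩, ⟨R.Y, rfl⟩, ⟨R.Qj, rfl⟩, ⟨R.D, rfl⟩, ⟨R.Fc, rfl⟩, ⟨R.E1, rfl⟩, ⟨R.E2, rfl⟩, ⟨R.TE, rfl⟩,
          ⟨R.U, rfl⟩, ⟨R.Bv, rfl⟩, ⟨R.E3, rfl⟩, ⟨R.J, rfl⟩, ⟨R.Z, rfl⟩, ⟨R.Z2, rfl⟩, ⟨R.TZ, rfl⟩, ⟨R.K, rfl⟩, ⟨R.D2, rfl⟩,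
          ⟨R.Bv2, rfl⟩, ⟨R.E4, rfl⟩, ⟨R.Db, rfl⟩, ⟨R.Bc, rfl⟩]
      rw [← hr, cfg₀_idx] at hw
      by_cases hb : r = R.Bc
      · subst hb
        rw [if_pos rfl] at hw
        have hoff : offOf (segs := segs P) w < wd P R.Bc := by
          have := offOf_lt w; rw [show segOf (segs := segs P) w = R.Bc.idx from hr.symm, segs_getD_idx] at this; exact this
        refine ⟨⟨_, hoff⟩, Fin.ext ?_, hw⟩
        show pre (segs P) R.Bc.idx + offOf (segs := segs P) w = w
        rw [hr]; exact pre_add_offOf w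
      · rw [if_neg hb, Nat.zero_testBit] at hw
        exact absurd hw Bool.false_ne_true
  · rintro (⟨j, rfl, hj⟩ | ⟨k, hk, i, o, rfl, ho⟩)
    · rw [lab_reg, cfg₀_idx, if_pos rfl, hj]
    · show lay (segs := segs P) (cfg₀ P) (emb (segs P) (hdrIdx P k i) o) = true
      rw [lay_emb, hdrOK_cfg₀ P k hk i i.isLt, Complexity.testBit_bitsToNat_eq_getD, ho]

/-! ### The constant-setting word -/

/-- The header field of a block is the header embedding. [folklore] -/
@[simp] theorem xblock_hdr (k : ℕ) (i : Fin (wd P (op P k).dst)) : (xblock P k).hdr i = hdr P k i := rfl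

/-- **The wires flipped by `constWord`**: the set bits of the header strings, then of `bin b` on `Bc`. [folklore] -/
def constWires : List (Fin (bw P)) :=
  ((List.range 26).flatMap fun k => (List.finRange (wd P (op P k).dst)).flatMap fun i : Fin (wd P (op P k).dst) =>
      ((List.finRange ((segs P).getD (hdrIdx P k i) 0)).filter fun o : Fin ((segs P).getD (hdrIdx P k i) 0) =>
        (hdrStr P (op P k) i).getD o.val false).map (hdr P k i)) ++
    ((List.finRange (wd P R.Bc)).filter fun j : Fin (wd P R.Bc) => (bits (wd P R.Bc) P.b).getD j.val false).map (reg P R.Bc)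

/-- `constWord` is the `X` word of `constWires`. [folklore] -/
theorem constWord_eq_xWords : constWord P = xWords (constWires P) := by
  simp only [constWord, constWires, setBits, xblock_hdr, flatMap_ite_xWord, flatMap_xWords, xWords_append]
  rfl

/-- **Membership in `constWires`.** [folklore] -/
theorem mem_constWires_iff (w : Fin (bw P)) :
    w ∈ constWires P ↔
      (∃ j : Fin (wd P R.Bc), reg P R.Bc j = w ∧ P.b.testBit j = true) ∨
        ∃ k, k < 26 ∧ ∃ i : Fin (wd P (op P k).dst), ∃ o : Fin ((segs P).getD (hdrIdx P k i) 0),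
          hdr P k i o = w ∧ (hdrStr P (op P k) i).getD o false = true := by
  unfold constWires
  simp only [List.mem_append, List.mem_flatMap, List.mem_range, List.mem_finRange, true_and, List.mem_map, List.mem_filter, getD_bits,
    Fin.is_lt, decide_true, Bool.true_and]
  constructor
  · rintro (⟨k, hk, i, o, ho, rfl⟩ | ⟨j, hj, rfl⟩)
    · exact Or.inr ⟨k, hk, i, o, rfl, ho⟩
    · exact Or.inl ⟨j, rfl, hj⟩
  · rintro (⟨j, rfl, hj⟩ | ⟨k, hk, i, o, rfl, ho⟩)
    · exact Or.inr ⟨j, hj, rfl⟩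
    · exact Or.inl ⟨k, hk, i, o, ho, rfl⟩

variable {P}

/-- Header wires determine their block, gate and position. [folklore] -/
theorem hdr_inj {k k' : ℕ} (hk : k < 26) (hk' : k' < 26) {i : Fin (wd P (op P k).dst)} {i' : Fin (wd P (op P k').dst)}
    {o : Fin ((segs P).getD (hdrIdx P k i) 0)} {o' : Fin ((segs P).getD (hdrIdx P k' i') 0)} (h : hdr P k i o = hdr P k' i' o') :
    k = k' ∧ (i : ℕ) = i' ∧ (o : ℕ) = o' := by
  have hseg : hdrIdx P k i = hdrIdx P k' i' := by
    by_contra hne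
    exact emb_ne (segs P) hne o o' h
  have hi : (i : ℕ) < (dws P).getD k 0 := by rw [dws_getD P hk]; exact i.isLt
  have hi' : (i' : ℕ) < (dws P).getD k' 0 := by rw [dws_getD P hk']; exact i'.isLt
  have hemb : emb (dws P) k ⟨i, hi⟩ = emb (dws P) k' ⟨i', hi'⟩ := by
    refine Fin.ext ?_
    rw [emb_val, emb_val]
    rw [hdrIdx_eq, hdrIdx_eq] at hseg
    simpa using hseg
  have hkk : k = k' := by
    by_contra hne
    exact emb_ne (dws P) hne _ _ hemb
  subst hkk
  have hii : (i : ℕ) = i' := by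
    have := congrArg Fin.val ((emb (dws P) k).injective hemb)
    simpa using this
  refine ⟨rfl, hii, ?_⟩
  have hv := congrArg Fin.val h
  have e1 : ((hdr P k i o : Fin (bw P)) : ℕ) = pre (segs P) (hdrIdx P k i) + o := rfl
  have e2 : ((hdr P k i' o' : Fin (bw P)) : ℕ) = pre (segs P) (hdrIdx P k i') + o' := rfl
  have e3 : pre (segs P) (hdrIdx P k i) = pre (segs P) (hdrIdx P k i') := by rw [hseg]
  rw [e1, e2] at hv
  omega

variable (P)

/-- **`constWires` is duplicate-free.** [folklore] -/
theorem constWires_nodup : (constWires P).Nodup := by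
  unfold constWires
  refine List.Nodup.append ?_ ?_ ?_
  · rw [List.nodup_flatMap]
    refine ⟨fun k hk => ?_, ?_⟩
    · rw [List.nodup_flatMap]
      refine ⟨fun i _ => (List.Nodup.filter _ (List.nodup_finRange _)).map (hdr P k i).injective, ?_⟩
      refine List.Pairwise.imp_of_mem ?_ (List.nodup_finRange _)
      intro i i' _ _ hne
      simp only [Function.onFun, List.disjoint_left, List.mem_map, List.mem_filter]
      rintro w ⟨o, -, rfl⟩ ⟨o', -, h⟩
      have := (hdr_inj (List.mem_range.1 hk) (List.mem_range.1 hk) h.symm).2.1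
      exact hne (Fin.ext this)
    · refine List.Pairwise.imp_of_mem ?_ (List.nodup_range)
      intro k k' hk hk' hne
      simp only [Function.onFun, List.disjoint_left, List.mem_flatMap, List.mem_map, List.mem_filter, List.mem_finRange, true_and]
      rintro w ⟨i, o, -, rfl⟩ ⟨i', o', -, h⟩
      exact hne (hdr_inj (List.mem_range.1 hk) (List.mem_range.1 hk') h.symm).1
  · exact (List.Nodup.filter _ (List.nodup_finRange _)).map (reg P R.Bc).injective
  · simp only [List.disjoint_left, List.mem_flatMap, List.mem_map, List.mem_filter, List.mem_range, List.mem_finRange, true_and]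
    rintro w ⟨k, -, i, o, -, rfl⟩ ⟨j, -, h⟩
    exact hdr_ne_reg P k i o R.Bc j h.symm

/-- **The constant-setting word prepares the label of the initial contents from `|0…0⟩`.**
[cite: VanDamSeroussi2002, §4 Algorithm 1] [cite: NielsenChuang2010, §4.2 Ex. 4.18] -/
theorem constWord_mulVec_basisState_zero (A : Language Bool) :
    (⟨constWord P⟩ : QCircuit cliffordT (bw P)).toMatrix A *ᵥ basisState (fun _ => false) = basisState (lab P (cfg₀ P)) := by
  rw [constWord_eq_xWords, xWords_mulVec_basisState_of_nodup A (constWires_nodup P)]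
  congr 1
  funext w
  rw [Bool.false_xor]
  by_cases h : lab P (cfg₀ P) w = true
  · rw [h, decide_eq_true ((mem_constWires_iff P w).2 ((lab_cfg₀_eq_true_iff P w).1 h))]
  · rw [Bool.not_eq_true] at h
    rw [h, decide_eq_false (fun hm => by have := (lab_cfg₀_eq_true_iff P w).2 ((mem_constWires_iff P w).1 hm); rw [h] at this; exact Bool.false_ne_true this)]

end VDSCopy

end Literature.Computability.Cryptography

end
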